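import Literature.Analysis.FluidPDE.ParticleTrajectoryGradientBounds
import Literature.Analysis.FunctionSpaces.HolderSeries
import HarnessLib

/-!
# The push-forward of a vector field by the particle-trajectory map: sup, Lipschitz and
# `C^{0,r}` bounds (frozen-in transport `w(X(α,t),t) = ∇_αX(α,t) u(α)`)

Literature file (topic `Analysis/FluidPDE`), sequel to `ParticleTrajectoryGradientBounds.lean`.
For a velocity field `u₀` on a convex time set `S` with particle-trajectory maps
`X(·,t) = φ(t, t₀, ·) = ODE.evolutionMap u₀ t₀ t` (Cauchy–Lipschitz hypotheses
`ODE.IsUniformlyLipschitzOn u₀ S`, joint smoothness `IsSmoothSpaceTimeOn S u₀`), the PUSH-FORWARD of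
a vector field `u` by `X(·,t)` is the field

  `w(z) = ∇_αX(α,t) u(α)` at `α = X⁻¹(z,t) = φ(t₀, t, z)`, i.e. `w(X(α,t)) = ∇_αX(α,t) u(α)`

— the frozen-in ("Cauchy formula") transport of Majda–Bertozzi's Lemma 1.4 / Prop. 1.8,
`h(X(α,t),t) = ∇_αX(α,t) h₀(α)` (1.51)/(1.57) (held text pp. 25–26; the tree's
`GeometricTransportFormula.lean`), and the "Lagrangian insertion" of the anomalous-dissipation
constructions (Armstrong–Vicol, arXiv:2305.05048 §2.2, p. 18: the next shear level is inserted in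
the Lagrangian coordinates of the coarse flow, `ψ_{m,k} ∘ X⁻¹_{m−1}`; for vector levels on `𝕋³` the
composition becomes the push-forward `(X_* v)(X y) = DX(y) v(y)`, cf. the tree's
`LagrangianLatticeCarrier.IsInserted`). This file gives the elementary size estimates of `w` in
terms of the a priori flow bounds of `TrajectoryGradientBound.lean` /
`ParticleTrajectoryGradientBounds.lean` (`‖∇X‖ ≤ e^{M|t−t₀|}`, `Lip(∇X) ≤ L e^{2M|t−t₀|}(e^{M|t−t₀|}−1)/M`,
`Lip(X⁻¹) ≤ e^{M|t−t₀|}` when `|∇u₀(·,s)|₀ ≤ M`, `|∇²u₀(·,s)|₀ ≤ L` between `t₀` and `t`):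

* §1 (generic, any pseudo-metric space `X`): `norm_clm_apply_le_mul`, `lipschitzWith_clm_apply` —
  for `A : X → (F →L[ℝ] G)` with `‖A x‖ ≤ a₀`, `A` `a₁`-Lipschitz, and `u : X → F` with
  `‖u x‖ ≤ b₀`, `u` `b₁`-Lipschitz, the field `x ↦ A x (u x)` is bounded by `a₀ b₀` and
  `(a₁ b₀ + a₀ b₁)`-Lipschitz (product rule at the Lipschitz level).
* §2 (on `E`): for `w z := ∇φ(t₀→t)(φ(t→t₀) z) (u (φ(t→t₀) z))`:
  `pushforward_evolutionMap_apply` (`w (X α) = ∇X(α) u(α)`), `norm_pushforward_evolutionMap_le`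
  (`‖w z‖ ≤ e^{M|t−t₀|} b₀`), `lipschitzWith_pushforward_evolutionMap`
  (`Lip(w) ≤ e^{M|t−t₀|}·(L e^{2M|t−t₀|} gronwallBound 0 M 1 |t−t₀|·b₀ + e^{M|t−t₀|} b₁)`), and the
  Hölder corollary `eBoundedHolderNorm_pushforward_evolutionMap_le` (Gilbarg–Trudinger
  interpolation `‖w‖_∞ + [w]_r ≤ B₀ + 2B₁^r (2B₀)^{1−r}`, the tree's
  `eBoundedHolderNorm_le_of_norm_le_of_lipschitzWith`).
* §3 (flat torus `𝕋ᵈ = UnitAddTorus d`, `E = EuclideanSpace ℝ d`):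
  `Torus.lipschitzWith_of_lipschitzWith_lift` (a torus function whose periodic lift is
  `C`-Lipschitz is `√d·C`-Lipschitz for the torus metric) and, for torus fields `b`, `v` related
  by the lifted insertion identity `b (proj (φ(t₀→t) y)) = ∇φ(t₀→t)(y) (v (proj y))` for all
  `y : E`: `Torus.norm_inserted_le` (`‖b z‖ ≤ e^{M|t−t₀|} ‖v‖_∞`), `Torus.lipschitzWith_inserted`,
  `Torus.eBoundedHolderNorm_inserted_le` — the per-level sup / Lipschitz / `C^{0,r}` inputs of a
  level-by-level regularity bookkeeping (cell ad-ideate, K3L `stub_regularL`,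
  `regular_of_levelBounds`).

All statements are theorems; no definitions, no named facts.

## References

* [MajdaBertozziCUP2002] A. J. Majda, A. L. Bertozzi, *Vorticity and Incompressible Flow*, CUP 2002,
  §1.6 Lemma 1.4 / Prop. 1.8, eqs. (1.51), (1.55)–(1.57) (held text pp. 25–26); §4.2 proof of
  Prop. 4.3, eqs. (4.45)–(4.47) (held text p. 133).
* [ArmstrongVicol2025] S. Armstrong, V. Vicol, *Anomalous diffusion by fractal homogenization*,
  Ann. PDE 11 (2025), arXiv:2305.05048, §2.2 (p. 18), Prop. 2.2 (p. 19), Cor. 2.4 (p. 22).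
* [GilbargTrudinger2001] D. Gilbarg, N. S. Trudinger, *Elliptic PDE of Second Order*, §4.1,
  (6.8)–(6.9).
-/

noncomputable section

open Set Function Filter Topology Metric
open scoped NNReal ENNReal ContDiff

namespace Literature.Analysis.FluidPDE

/-! ### §1 The product rule at the Lipschitz level -/

section Generic

variable {X : Type*} [PseudoMetricSpace X]
variable {F : Type*} [NormedAddCommGroup F] [NormedSpace ℝ F]
variable {G : Type*} [NormedAddCommGroup G] [NormedSpace ℝ G]

omit [PseudoMetricSpace X] in
/-- `‖A x (u x)‖ ≤ a₀ b₀` when `‖A x‖ ≤ a₀` and `‖u x‖ ≤ b₀`. [cite: MajdaBertozziCUP2002, §1.6 Prop. 1.8 eq. (1.51) (held text p. 25)] -/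
theorem norm_clm_apply_le_mul {A : X → F →L[ℝ] G} {u : X → F} {a₀ b₀ : ℝ}
    (hA0 : ∀ x, ‖A x‖ ≤ a₀) (hu0 : ∀ x, ‖u x‖ ≤ b₀) (x : X) : ‖A x (u x)‖ ≤ a₀ * b₀ :=
  (ContinuousLinearMap.le_opNorm _ _).trans
    (mul_le_mul (hA0 x) (hu0 x) (norm_nonneg _) ((norm_nonneg _).trans (hA0 x)))

/-- **Product rule at the Lipschitz level.** If `‖A x‖ ≤ a₀`, `A` is `a₁`-Lipschitz (operator
norm), `‖u x‖ ≤ b₀` and `u` is `b₁`-Lipschitz, then `x ↦ A x (u x)` is `(a₁ b₀ + a₀ b₁)`-Lipschitz: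
`A x (u x) − A y (u y) = (A x − A y)(u x) + A y (u x − u y)`. [cite: MajdaBertozziCUP2002, §1.6 Lemma 1.4 eq. (1.57) (held text p. 26)] -/
theorem lipschitzWith_clm_apply {A : X → F →L[ℝ] G} {u : X → F} {a₀ a₁ b₀ b₁ : ℝ≥0}
    (hA0 : ∀ x, ‖A x‖ ≤ a₀) (hA1 : LipschitzWith a₁ A) (hu0 : ∀ x, ‖u x‖ ≤ b₀)
    (hu1 : LipschitzWith b₁ u) : LipschitzWith (a₁ * b₀ + a₀ * b₁) fun x => A x (u x) := by
  refine LipschitzWith.of_dist_le_mul fun x y => ?_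
  have h1 := hA1.dist_le_mul x y
  have h2 := hu1.dist_le_mul x y
  rw [dist_eq_norm] at h1 h2 ⊢
  have hsplit : A x (u x) - A y (u y) = (A x - A y) (u x) + A y (u x - u y) := by
    simp only [sub_apply, map_sub]; abel
  rw [hsplit]
  calc ‖(A x - A y) (u x) + A y (u x - u y)‖
      ≤ ‖(A x - A y) (u x)‖ + ‖A y (u x - u y)‖ := norm_add_le _ _
    _ ≤ ‖A x - A y‖ * ‖u x‖ + ‖A y‖ * ‖u x - u y‖ :=
        add_le_add (ContinuousLinearMap.le_opNorm _ _) (ContinuousLinearMap.le_opNorm _ _)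
    _ ≤ (a₁ * dist x y) * b₀ + a₀ * (b₁ * dist x y) :=
        add_le_add (mul_le_mul h1 (hu0 x) (norm_nonneg _) (by positivity))
          (mul_le_mul (hA0 y) h2 (norm_nonneg _) ((norm_nonneg _).trans (hA0 y)))
    _ = ↑(a₁ * b₀ + a₀ * b₁) * dist x y := by push_cast; ring

variable {H : Type*} [NormedAddCommGroup H] [NormedSpace ℝ H]

omit [PseudoMetricSpace X] in
/-- `‖(P x) ∘ (Q x)‖ ≤ p₀ q₀` when `‖P x‖ ≤ p₀` and `‖Q x‖ ≤ q₀` (operator norms).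
[cite: MajdaBertozziCUP2002, §4.2 proof of Prop. 4.3 eq. (4.45) (held text p. 133)] -/
theorem norm_clm_comp_le_mul {P : X → G →L[ℝ] H} {Q : X → F →L[ℝ] G} {p₀ q₀ : ℝ}
    (hP0 : ∀ x, ‖P x‖ ≤ p₀) (hQ0 : ∀ x, ‖Q x‖ ≤ q₀) (x : X) : ‖(P x).comp (Q x)‖ ≤ p₀ * q₀ :=
  (ContinuousLinearMap.opNorm_comp_le _ _).trans
    (mul_le_mul (hP0 x) (hQ0 x) (norm_nonneg _) ((norm_nonneg _).trans (hP0 x)))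

/-- **Product rule at the Lipschitz level for compositions of operator fields** (the chain rule
`∇(A ∘ Y)(z) = ∇A(Y z) ∘ ∇Y(z)` read at the Lipschitz level: frames composed along nested flow
maps): if `‖P x‖ ≤ p₀`, `P` is `p₁`-Lipschitz, `‖Q x‖ ≤ q₀` and `Q` is `q₁`-Lipschitz (operator
norms), then `x ↦ (P x) ∘ (Q x)` is `(p₁ q₀ + p₀ q₁)`-Lipschitz:
`P x ∘ Q x − P y ∘ Q y = (P x − P y) ∘ Q x + P y ∘ (Q x − Q y)`.
[cite: MajdaBertozziCUP2002, §4.2 proof of Prop. 4.3 eq. (4.45) (held text p. 133); §1.6 Lemma 1.4 (1.57)] -/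
theorem lipschitzWith_clm_comp {P : X → G →L[ℝ] H} {Q : X → F →L[ℝ] G} {p₀ p₁ q₀ q₁ : ℝ≥0}
    (hP0 : ∀ x, ‖P x‖ ≤ p₀) (hP1 : LipschitzWith p₁ P) (hQ0 : ∀ x, ‖Q x‖ ≤ q₀)
    (hQ1 : LipschitzWith q₁ Q) :
    LipschitzWith (p₁ * q₀ + p₀ * q₁) fun x => (P x).comp (Q x) := by
  refine LipschitzWith.of_dist_le_mul fun x y => ?_
  have h1 := hP1.dist_le_mul x y
  have h2 := hQ1.dist_le_mul x y
  rw [dist_eq_norm] at h1 h2 ⊢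
  have hsplit : (P x).comp (Q x) - (P y).comp (Q y) =
      (P x - P y).comp (Q x) + (P y).comp (Q x - Q y) := by
    rw [ContinuousLinearMap.sub_comp, ContinuousLinearMap.comp_sub]; abel
  rw [hsplit]
  calc ‖(P x - P y).comp (Q x) + (P y).comp (Q x - Q y)‖
      ≤ ‖(P x - P y).comp (Q x)‖ + ‖(P y).comp (Q x - Q y)‖ := norm_add_le _ _
    _ ≤ ‖P x - P y‖ * ‖Q x‖ + ‖P y‖ * ‖Q x - Q y‖ :=
        add_le_add (ContinuousLinearMap.opNorm_comp_le _ _)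
          (ContinuousLinearMap.opNorm_comp_le _ _)
    _ ≤ (p₁ * dist x y) * q₀ + p₀ * (q₁ * dist x y) :=
        add_le_add (mul_le_mul h1 (hQ0 x) (norm_nonneg _) (by positivity))
          (mul_le_mul (hP0 y) h2 (norm_nonneg _) ((norm_nonneg _).trans (hP0 y)))
    _ = ↑(p₁ * q₀ + p₀ * q₁) * dist x y := by push_cast; ring

end Generic

/-! ### §2 The push-forward by the particle-trajectory map on `E` -/

section Pushforward

variable {E : Type*} [NormedAddCommGroup E] [NormedSpace ℝ E] [CompleteSpace E]
variable {u₀ : ℝ → E → E} {S : Set ℝ} {t₀ t : ℝ}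

/-- **The push-forward evaluated on the trajectory**: with
`w z := ∇φ(t₀→t)(φ(t→t₀) z) (u (φ(t→t₀) z))`, `w (φ(t₀→t) α) = ∇φ(t₀→t)(α) (u α)` — MB (1.57)
`h(X(α,t),t) = ∇_αX(α,t) h₀(α)` as the definition of the transported field.
[cite: MajdaBertozziCUP2002, §1.6 Lemma 1.4 eq. (1.57) (held text p. 26)] -/
theorem pushforward_evolutionMap_apply (hL : ODE.IsUniformlyLipschitzOn u₀ S) (hS : Convex ℝ S)
    (ht₀ : t₀ ∈ S) (ht : t ∈ S) (u : E → E) (α : E) :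
    fderiv ℝ (ODE.evolutionMap u₀ t₀ t) (ODE.evolutionMap u₀ t t₀ (ODE.evolutionMap u₀ t₀ t α))
        (u (ODE.evolutionMap u₀ t t₀ (ODE.evolutionMap u₀ t₀ t α))) =
      fderiv ℝ (ODE.evolutionMap u₀ t₀ t) α (u α) := by
  rw [hL.evolutionMap_symm hS ht₀ ht]

/-- **Sup bound of the push-forward**: if `‖∇u₀(s)(·)‖ ≤ M` between `t₀` and `t` and
`‖u‖ ≤ b₀`, then `‖∇φ(t₀→t)(φ(t→t₀) z) (u (φ(t→t₀) z))‖ ≤ e^{M|t−t₀|} b₀` (MB (4.47) for the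
gradient factor). [cite: MajdaBertozziCUP2002, §4.2 proof of Prop. 4.3 eq. (4.47) (held text p. 133)] -/
theorem norm_pushforward_evolutionMap_le (hL : ODE.IsUniformlyLipschitzOn u₀ S)
    (hu₀ : IsSmoothSpaceTimeOn S u₀) (hS : Convex ℝ S) (hU : UniqueDiffOn ℝ S) (ht₀ : t₀ ∈ S)
    (ht : t ∈ S) {M : ℝ} (hM : ∀ s ∈ uIcc t₀ t, ∀ y, ‖fderiv ℝ (u₀ s) y‖ ≤ M) {u : E → E}
    {b₀ : ℝ} (hu0 : ∀ y, ‖u y‖ ≤ b₀) (z : E) :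
    ‖fderiv ℝ (ODE.evolutionMap u₀ t₀ t) (ODE.evolutionMap u₀ t t₀ z)
        (u (ODE.evolutionMap u₀ t t₀ z))‖ ≤ Real.exp (M * |t - t₀|) * b₀ :=
  norm_clm_apply_le_mul (A := fun x => fderiv ℝ (ODE.evolutionMap u₀ t₀ t) x)
    (fun x => norm_fderiv_evolutionMap_le hL hu₀ hS hU ht₀ ht hM x) hu0 _

/-- **Lipschitz bound of the push-forward**: if `‖∇u₀(s)(·)‖ ≤ M`, `‖∇²u₀(s)(·)‖ ≤ L` between
`t₀` and `t`, `‖u‖ ≤ b₀` and `u` is `b₁`-Lipschitz, then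
`z ↦ ∇φ(t₀→t)(φ(t→t₀) z) (u (φ(t→t₀) z))` is Lipschitz with constant
`e^{M|t−t₀|} · (L e^{2M|t−t₀|} gronwallBound 0 M 1 |t−t₀| · b₀ + e^{M|t−t₀|} · b₁)`
(product rule at the Lipschitz level; `Lip(∇φ)` from `norm_fderiv_evolutionMap_sub_fderiv_le`,
`‖∇φ‖ ≤ e^{M|t−t₀|}` from (4.47), `Lip(φ(t→t₀)) ≤ e^{M|t−t₀|}` from Teschl (2.43)).
[cite: MajdaBertozziCUP2002, §4.2 proof of Prop. 4.3 eqs. (4.45)–(4.47) (held text p. 133); §1.6 Lemma 1.4 (1.57)]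
[cite: BuckmasterEtAl2018, App. B Prop. B.1 (B.4)–(B.5)] -/
theorem lipschitzWith_pushforward_evolutionMap (hL : ODE.IsUniformlyLipschitzOn u₀ S)
    (hu₀ : IsSmoothSpaceTimeOn S u₀) (hS : Convex ℝ S) (hU : UniqueDiffOn ℝ S) (ht₀ : t₀ ∈ S)
    (ht : t ∈ S) {M L : ℝ} (hM : ∀ s ∈ uIcc t₀ t, ∀ y, ‖fderiv ℝ (u₀ s) y‖ ≤ M)
    (hL2 : ∀ s ∈ uIcc t₀ t, ∀ y, ‖iteratedFDeriv ℝ 2 (u₀ s) y‖ ≤ L) {u : E → E} {b₀ b₁ : ℝ≥0}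
    (hu0 : ∀ y, ‖u y‖ ≤ b₀) (hu1 : LipschitzWith b₁ u) :
    LipschitzWith
      (Real.toNNReal (Real.exp (M * |t - t₀|) *
        (L * Real.exp (2 * M * |t - t₀|) * gronwallBound 0 M 1 |t - t₀| * b₀ +
          Real.exp (M * |t - t₀|) * b₁)))
      fun z => fderiv ℝ (ODE.evolutionMap u₀ t₀ t) (ODE.evolutionMap u₀ t t₀ z)
        (u (ODE.evolutionMap u₀ t t₀ z)) := by
  have hsub := hS.ordConnected.uIcc_subset ht₀ ht
  have hM0 : 0 ≤ M := (norm_nonneg _).trans (hM t₀ left_mem_uIcc 0)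
  have hL0 : 0 ≤ L := (norm_nonneg _).trans (hL2 t₀ left_mem_uIcc 0)
  have hτ0 : 0 ≤ |t - t₀| := abs_nonneg _
  have hG0 : 0 ≤ gronwallBound 0 M 1 |t - t₀| := by
    have := gronwallBound_mono (δ := 0) (K := M) (ε := 1) le_rfl zero_le_one hM0 hτ0
    rwa [gronwallBound_x0] at this
  -- the three constants as nonnegative reals
  set a₀ : ℝ≥0 := Real.toNNReal (Real.exp (M * |t - t₀|)) with ha₀
  set a₁ : ℝ≥0 := Real.toNNReal (L * Real.exp (2 * M * |t - t₀|) * gronwallBound 0 M 1 |t - t₀|)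
    with ha₁
  have ha₀' : (a₀ : ℝ) = Real.exp (M * |t - t₀|) := Real.coe_toNNReal _ (Real.exp_pos _).le
  have ha₁' : (a₁ : ℝ) = L * Real.exp (2 * M * |t - t₀|) * gronwallBound 0 M 1 |t - t₀| :=
    Real.coe_toNNReal _ (by positivity)
  -- `‖∇φ‖ ≤ a₀`, `Lip(∇φ) ≤ a₁`
  have hA0 : ∀ x, ‖fderiv ℝ (ODE.evolutionMap u₀ t₀ t) x‖ ≤ a₀ := fun x => by
    rw [ha₀']; exact norm_fderiv_evolutionMap_le hL hu₀ hS hU ht₀ ht hM x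
  have hA1 : LipschitzWith a₁ fun x => fderiv ℝ (ODE.evolutionMap u₀ t₀ t) x := by
    rw [ha₁]; exact lipschitzWith_fderiv_evolutionMap hL hu₀ hS hU ht₀ ht hM hL2
  -- `Lip(φ(t→t₀)) ≤ a₀` (the same gradient bound between `t` and `t₀`)
  have hlipu : ∀ s ∈ uIcc t t₀, LipschitzWith (Real.toNNReal M) (u₀ s) := fun s hs => by
    rw [uIcc_comm] at hs
    exact lipschitzWith_slice_of_norm_fderiv_le hu₀ (hsub hs) (K := Real.toNNReal M)
      (fun y => by rw [Real.coe_toNNReal _ hM0]; exact hM s hs y)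
  have hΨ : LipschitzWith a₀ (ODE.evolutionMap u₀ t t₀) := by
    refine LipschitzWith.of_dist_le_mul fun x y => ?_
    have h := hL.dist_evolutionMap_le hS ht ht₀ hlipu x y
    rw [Real.coe_toNNReal _ hM0, abs_sub_comm] at h
    rw [ha₀', mul_comm]
    exact h
  -- assemble
  have hprod := lipschitzWith_clm_apply hA0 hA1 hu0 hu1
  have hcomp := hprod.comp hΨ
  have hconst : (a₁ * b₀ + a₀ * b₁) * a₀ =
      Real.toNNReal (Real.exp (M * |t - t₀|) *
        (L * Real.exp (2 * M * |t - t₀|) * gronwallBound 0 M 1 |t - t₀| * b₀ +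
          Real.exp (M * |t - t₀|) * b₁)) := by
    apply NNReal.coe_injective
    rw [Real.coe_toNNReal _ (by positivity)]
    push_cast
    rw [ha₀', ha₁']
    ring
  rw [← hconst]
  exact hcomp

/-- **`C^{0,r}` bound of the push-forward** (`r ≤ 1`): with `B₀ = e^{M|t−t₀|} b₀` (sup) and `B₁`
the Lipschitz constant of `lipschitzWith_pushforward_evolutionMap`,
`‖w‖_∞ + [w]_r ≤ B₀ + 2 B₁^r (2B₀)^{1−r}` (Gilbarg–Trudinger interpolation, the tree's
`eBoundedHolderNorm_le_of_norm_le_of_lipschitzWith`). [cite: GilbargTrudinger2001, §4.1 and (6.8)–(6.9)]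
[cite: MajdaBertozziCUP2002, §4.2 proof of Prop. 4.3 eqs. (4.45)–(4.47) (held text p. 133)] -/
theorem eBoundedHolderNorm_pushforward_evolutionMap_le (hL : ODE.IsUniformlyLipschitzOn u₀ S)
    (hu₀ : IsSmoothSpaceTimeOn S u₀) (hS : Convex ℝ S) (hU : UniqueDiffOn ℝ S) (ht₀ : t₀ ∈ S)
    (ht : t ∈ S) {M L : ℝ} (hM : ∀ s ∈ uIcc t₀ t, ∀ y, ‖fderiv ℝ (u₀ s) y‖ ≤ M)
    (hL2 : ∀ s ∈ uIcc t₀ t, ∀ y, ‖iteratedFDeriv ℝ 2 (u₀ s) y‖ ≤ L) {u : E → E} {b₀ b₁ : ℝ≥0}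
    (hu0 : ∀ y, ‖u y‖ ≤ b₀) (hu1 : LipschitzWith b₁ u) {r : ℝ≥0} (hr : r ≤ 1) :
    FunctionSpaces.eBoundedHolderNorm r
        (fun z => fderiv ℝ (ODE.evolutionMap u₀ t₀ t) (ODE.evolutionMap u₀ t t₀ z)
          (u (ODE.evolutionMap u₀ t t₀ z))) ≤
      ((Real.toNNReal (Real.exp (M * |t - t₀|)) * b₀ +
          2 * (Real.toNNReal (Real.exp (M * |t - t₀|) *
              (L * Real.exp (2 * M * |t - t₀|) * gronwallBound 0 M 1 |t - t₀| * b₀ +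
                Real.exp (M * |t - t₀|) * b₁))) ^ (r : ℝ) *
            (2 * (Real.toNNReal (Real.exp (M * |t - t₀|)) * b₀)) ^ (1 - r : ℝ) : ℝ≥0) : ℝ≥0∞) := by
  refine FunctionSpaces.eBoundedHolderNorm_le_of_norm_le_of_lipschitzWith (fun z => ?_)
    (lipschitzWith_pushforward_evolutionMap hL hu₀ hS hU ht₀ ht hM hL2 hu0 hu1) hr
  push_cast
  rw [Real.coe_toNNReal _ (Real.exp_pos _).le]
  exact norm_pushforward_evolutionMap_le hL hu₀ hS hU ht₀ ht hM hu0 z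

end Pushforward

/-! ### §3 On the flat torus: lifted Lipschitz constants and inserted levels -/

section TorusTransfer

open FunctionSpaces FunctionSpaces.Torus

variable {d : Type*} [Fintype d]
variable {F : Type*} [NormedAddCommGroup F]

/-- **A torus function whose periodic lift is `C`-Lipschitz is `√d·C`-Lipschitz** for the torus
metric (good lifts: `‖a − b‖ ≤ √d · dist (proj a) (proj b)`, the tree's
`Torus.exists_lift_norm_sub_le`; functions on `𝕋ᵈ` = `ℤᵈ`-periodic functions on `ℝᵈ`).
[cite: Grafakos2014, §3.1.1] [cite: GilbargTrudinger2001, §4.1] -/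
theorem Torus.lipschitzWith_of_lipschitzWith_lift {f : UnitAddTorus d → F} {C : ℝ≥0}
    (h : LipschitzWith C (lift f)) :
    LipschitzWith (NNReal.sqrt (Fintype.card d) * C) f := by
  refine LipschitzWith.of_dist_le_mul fun x y => ?_
  obtain ⟨a, b, rfl, rfl, hab⟩ := exists_lift_norm_sub_le x y
  have h1 := h.dist_le_mul a b
  rw [lift_apply, lift_apply, dist_eq_norm (a := a)] at h1
  refine h1.trans ?_
  calc (C : ℝ) * ‖a - b‖ ≤ C * (Real.sqrt (Fintype.card d) * dist (proj a) (proj b)) :=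
        mul_le_mul_of_nonneg_left hab C.coe_nonneg
    _ = ↑(NNReal.sqrt (Fintype.card d) * C) * dist (proj a) (proj b) := by push_cast; ring

end TorusTransfer

section Inserted

open FunctionSpaces FunctionSpaces.Torus

variable {d : Type*} [Fintype d]
variable {u₀ : ℝ → EuclideanSpace ℝ d → EuclideanSpace ℝ d} {S : Set ℝ} {t₀ t : ℝ}

/-- **Sup bound of an inserted (pushed-forward) torus level.** Let `b, v : 𝕋ᵈ → ℝᵈ` satisfy the
lifted insertion identity `b (proj (φ(t₀→t) y)) = ∇φ(t₀→t)(y) (v (proj y))` for all `y ∈ ℝᵈ`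
(`b = (X_* v)`, the next Lagrangian level of an Armstrong–Vicol-type construction), where `φ`
is the evolution map of a field `u₀` with `‖∇u₀(s)(·)‖ ≤ M` between `t₀` and `t`. Then
`‖b z‖ ≤ e^{M|t−t₀|} ‖v‖_∞`. [cite: ArmstrongVicol2025, §2.2 (p. 18) and Cor. 2.4 (p. 22)]
[cite: MajdaBertozziCUP2002, §4.2 proof of Prop. 4.3 eq. (4.47) (held text p. 133)] -/
theorem Torus.norm_inserted_le (hL : ODE.IsUniformlyLipschitzOn u₀ S)
    (hu₀ : IsSmoothSpaceTimeOn S u₀) (hS : Convex ℝ S) (hU : UniqueDiffOn ℝ S) (ht₀ : t₀ ∈ S)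
    (ht : t ∈ S) {M : ℝ} (hM : ∀ s ∈ uIcc t₀ t, ∀ y, ‖fderiv ℝ (u₀ s) y‖ ≤ M)
    {b v : UnitAddTorus d → EuclideanSpace ℝ d}
    (hb : ∀ y, b (proj (ODE.evolutionMap u₀ t₀ t y)) = fderiv ℝ (ODE.evolutionMap u₀ t₀ t) y (v (proj y)))
    {b₀ : ℝ} (hv0 : ∀ x, ‖v x‖ ≤ b₀) (z : UnitAddTorus d) :
    ‖b z‖ ≤ Real.exp (M * |t - t₀|) * b₀ := by
  obtain ⟨ζ, rfl⟩ := proj_surjective z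
  have hζ : ζ = ODE.evolutionMap u₀ t₀ t (ODE.evolutionMap u₀ t t₀ ζ) :=
    (hL.evolutionMap_symm hS ht ht₀ ζ).symm
  rw [hζ, hb]
  exact norm_pushforward_evolutionMap_le hL hu₀ hS hU ht₀ ht hM (u := lift v)
    (fun y => hv0 (proj y)) ζ

/-- **Lipschitz bound of an inserted torus level**: under the lifted insertion identity, with
`‖∇u₀(s)(·)‖ ≤ M`, `‖∇²u₀(s)(·)‖ ≤ L` between `t₀` and `t`, `‖v‖ ≤ b₀` and `lift v`
`b₁`-Lipschitz, the level `b` is Lipschitz on `𝕋ᵈ` with constant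
`√d · e^{M|t−t₀|}(L e^{2M|t−t₀|} gronwallBound 0 M 1 |t−t₀|·b₀ + e^{M|t−t₀|} b₁)` (its lift IS the
push-forward field of §2). [cite: ArmstrongVicol2025, §2.2 (p. 18), Prop. 2.2 (p. 19), Cor. 2.4 (p. 22)]
[cite: MajdaBertozziCUP2002, §4.2 proof of Prop. 4.3 eqs. (4.45)–(4.47) (held text p. 133)] -/
theorem Torus.lipschitzWith_inserted (hL : ODE.IsUniformlyLipschitzOn u₀ S)
    (hu₀ : IsSmoothSpaceTimeOn S u₀) (hS : Convex ℝ S) (hU : UniqueDiffOn ℝ S) (ht₀ : t₀ ∈ S)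
    (ht : t ∈ S) {M L : ℝ} (hM : ∀ s ∈ uIcc t₀ t, ∀ y, ‖fderiv ℝ (u₀ s) y‖ ≤ M)
    (hL2 : ∀ s ∈ uIcc t₀ t, ∀ y, ‖iteratedFDeriv ℝ 2 (u₀ s) y‖ ≤ L)
    {b v : UnitAddTorus d → EuclideanSpace ℝ d}
    (hb : ∀ y, b (proj (ODE.evolutionMap u₀ t₀ t y)) = fderiv ℝ (ODE.evolutionMap u₀ t₀ t) y (v (proj y)))
    {b₀ b₁ : ℝ≥0} (hv0 : ∀ x, ‖v x‖ ≤ b₀) (hv1 : LipschitzWith b₁ (lift v)) :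
    LipschitzWith
      (NNReal.sqrt (Fintype.card d) *
        Real.toNNReal (Real.exp (M * |t - t₀|) *
          (L * Real.exp (2 * M * |t - t₀|) * gronwallBound 0 M 1 |t - t₀| * b₀ +
            Real.exp (M * |t - t₀|) * b₁)))
      b := by
  refine Torus.lipschitzWith_of_lipschitzWith_lift ?_
  have hw := lipschitzWith_pushforward_evolutionMap hL hu₀ hS hU ht₀ ht hM hL2 (u := lift v)
    (fun y => hv0 (proj y)) hv1
  have hfun : (fun z => fderiv ℝ (ODE.evolutionMap u₀ t₀ t) (ODE.evolutionMap u₀ t t₀ z)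
      (lift v (ODE.evolutionMap u₀ t t₀ z))) = lift b := by
    funext z
    have hz := hb (ODE.evolutionMap u₀ t t₀ z)
    rw [hL.evolutionMap_symm hS ht ht₀ z] at hz
    rw [lift_apply, lift_apply, hz]
  rw [← hfun]
  exact hw

/-- **`C^{0,r}` bound of an inserted torus level** (`r ≤ 1`): with `B₀ = e^{M|t−t₀|} b₀` and `B₁`
the Lipschitz constant of `Torus.lipschitzWith_inserted`, `‖b‖_∞ + [b]_r ≤ B₀ + 2B₁^r(2B₀)^{1−r}` on
`𝕋ᵈ` (Gilbarg–Trudinger interpolation) — the per-level `C^{0,r}` majorant of a Lagrangian level.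
[cite: GilbargTrudinger2001, §4.1 and (6.8)–(6.9)] [cite: ArmstrongVicol2025, §2.2 (p. 18), Cor. 2.4 (p. 22)] -/
theorem Torus.eBoundedHolderNorm_inserted_le (hL : ODE.IsUniformlyLipschitzOn u₀ S)
    (hu₀ : IsSmoothSpaceTimeOn S u₀) (hS : Convex ℝ S) (hU : UniqueDiffOn ℝ S) (ht₀ : t₀ ∈ S)
    (ht : t ∈ S) {M L : ℝ} (hM : ∀ s ∈ uIcc t₀ t, ∀ y, ‖fderiv ℝ (u₀ s) y‖ ≤ M)
    (hL2 : ∀ s ∈ uIcc t₀ t, ∀ y, ‖iteratedFDeriv ℝ 2 (u₀ s) y‖ ≤ L)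
    {b v : UnitAddTorus d → EuclideanSpace ℝ d}
    (hb : ∀ y, b (proj (ODE.evolutionMap u₀ t₀ t y)) = fderiv ℝ (ODE.evolutionMap u₀ t₀ t) y (v (proj y)))
    {b₀ b₁ : ℝ≥0} (hv0 : ∀ x, ‖v x‖ ≤ b₀) (hv1 : LipschitzWith b₁ (lift v)) {r : ℝ≥0} (hr : r ≤ 1) :
    eBoundedHolderNorm r b ≤
      ((Real.toNNReal (Real.exp (M * |t - t₀|)) * b₀ +
          2 * (NNReal.sqrt (Fintype.card d) *
              Real.toNNReal (Real.exp (M * |t - t₀|) *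
                (L * Real.exp (2 * M * |t - t₀|) * gronwallBound 0 M 1 |t - t₀| * b₀ +
                  Real.exp (M * |t - t₀|) * b₁))) ^ (r : ℝ) *
            (2 * (Real.toNNReal (Real.exp (M * |t - t₀|)) * b₀)) ^ (1 - r : ℝ) : ℝ≥0) : ℝ≥0∞) := by
  refine eBoundedHolderNorm_le_of_norm_le_of_lipschitzWith (fun z => ?_)
    (Torus.lipschitzWith_inserted hL hu₀ hS hU ht₀ ht hM hL2 hb hv0 hv1) hr
  push_cast
  rw [Real.coe_toNNReal _ (Real.exp_pos _).le]
  exact Torus.norm_inserted_le hL hu₀ hS hU ht₀ ht hM hb hv0 z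

end Inserted

end Literature.Analysis.FluidPDE
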